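import Summits.QuantumFields.BalabanUV.T4Continuum.Support.ShellMeasureRootCompositionLevelZero

/-!
# `T4Continuum.ShellMeasureRootCompositionFibre` — END-II ON A FLUCTUATION FIBRE: the per-slot anti-concentration (M1)
# for a realized slot law of the shape «additive Haar measure on a finite-dimensional real space of block fluctuation
# coordinates × ANY s-finite exterior law, with density» — the shape of print's δ-constrained, gauge-fixed fluctuation
# integral AFTER its own chart of the «approximate fluctuation field» — from the SAME level data as E2′, with NO
# product-Haar model of the level-`j` bonds, NO `SU(2)` exponential chart and NO gauge hypothesis
# (cell `pub-balaban`, sub-cell `t4`, spine estimate NE7c (node U5b); NE7c ROUND-2 crew `t4-ne7c-formalise-*`, seat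
# leaf-10 (gen 2), file 3 of the OFFERED row «(LR)_j with print's fixed centre» (journal l.7391 / l.7552 / l.7719,
# LOCATOR l.7826 = GAPS G-ne7cL10g2-1 (R3)); ADDITIVE — imports `ShellMeasureRootCompositionLevelZero` (p208890) only,
# modifies nothing)

HONEST FRAMING.  Finite four-torus programme, rung (B)+1 only — NOT infinite volume, NOT a mass gap, NOT the Clay
problem, NOT summit progress; (B), `BetaPertHyp`, (B^μ) are not consumed.  (M1) for Bałaban's inductively defined
effective measures is NOT PRINTED (GAPS G-ne7cp1-1), asserted by nobody, NOT moved here.  NE7c ⇐ the named binders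
(trigger c3); NE7c NOT PRINTED, NOT proved; spine PROVED 0/9 before and after.  STRUCTURAL BOOKKEEPING — no estimate,
0 sorry, 0 citations, no `def` (c2).  HONEST DEPENDENCY (cell): continuum YM on T⁴ ⇐ BetaPertH ∧ nine spine estimates
(0/9 proved); BetaPertH ⇐ (D1) ∧ (D4) ∧ CAP+tail; G-an2-4 gates asym, D1 and NE2/3/4.

THE POINT (GAPS G-ne7cL10g2-1 (R3)).  Every END-II in the tree (E2 `ShellMeasureRootCompositionSU2`, E2′
`…LevelZero.slotAC_realized_su2_of_levelData_cube`, the raw ∕ fixed-centre ENDs of `ShellMeasureWindowFixedCentre`,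
S15, S20) types the slot's realized law as `(fieldMeasure P j SU2).withDensity F` — PRODUCT HAAR on the level-`j`
bonds with a density.  Print's level-`j` fluctuation integral ([Balaban1989LargeFieldI] (1.25) p. 182 = B14 (2.21))
integrates `dV_j` against the AVERAGING CONSTRAINT `δ(V̄_j V_{j+1}^{-1})`: conditionally on the coarse field the law
lives on the fibre `{V̄_j = V_{j+1}}`, which is NOT absolutely continuous w.r.t. product Haar; print then charts the
«approximate fluctuation field» `V_j(b)(V^{(j)}_Z(b))^{-1}` about the fixed centre (1.26).  So the realized shape the
[dict] push can honestly deliver at a live level is: an additive Haar measure `μ` on a finite-dimensional real space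
`E` of BLOCK FLUCTUATION COORDINATES (e.g. the linearised fibre `ker Q` of the block, or `ℝ^m`) times ANY s-finite
exterior law `ζ`, with a density `F` (print's gauge-fixed integrand ∘ the fibre chart × its Jacobian).  For that shape
END-II needs neither the `SU(2)` chart `chart_su2` nor the product-Haar disintegration nor any gauge hypothesis: it is
`T4ShellMeasureLocal.slotAntiConcentration_of_sections` (frozen exterior) ∘ the one-depth assembly
`ShellMeasureLevelAssembly.slotAntiConcentration_of_levelData` (generic in `E`, `μ`) ∘
`ShellMeasureRootCompositionLevelZero.slotAntiConcentration_congr_offNull` (tested variable read on the support).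
* §1 `slotAC_block_of_levelData` — ONE block, exterior frozen: (M1) for `μ.withDensity F₀` on `E` from E2′'s level
  data IN THE FLUCTUATION COORDINATES, the dictionary `F₀ = Jco · weight` pointwise and `u₀ = classifier` on the support.
* §2 `slotAC_fibre_of_levelData` — THE FIBRE END: (M1) for `((μ.prod ζ).withDensity F)` on `E × Z`, tested variable
  `u : E × Z → ℝ`, from the level data of every exterior point `z`; constant LITERALLY E2′'s with `n ↦ finrank ℝ E`:
  `2(finrank ℝ E + β Σ_p L̄_p(d̄_p + 4s̄_p) + B_𝓔)/(1−δ)`.  END-I's seam `ShellMeasureRootCompositionSeam.hac_of_slotConst`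
  (ANY slot family) consumes it unchanged.
CONSEQUENCE FOR THE LEDGER (c3-honest).  The live-level [dict] obligation becomes PRECISE AND SMALLER: supply
`(E, μ, Z, ζ, F, u)` — the block's fluctuation coordinates with print's integrand pulled back — and the level data in
those coordinates; the product-Haar-on-bonds model and the `SU(2)` chart are needed only where they are honest (level 0:
S11/S17/S19; the raw ∕ tree-gauge ENDs).  The window (1.27) is a centre-monotone co-test inside `Jco` in these
coordinates (a ball about `0`).  Nothing printed is asserted; the fibre chart itself (B12 §1 ∕ B13) stays DISPLAYED.
WHAT THIS DOES NOT DO.  No instance of SM-L1/L3/L4/L6 at any `j ≥ 1`; no chart of Bałaban's constraint surface is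
constructed; (M1) per slot stays THE wall; NE7c NOT proved; 0/9 spine.
-/

noncomputable section

open NormedSpace Set Function MeasureTheory Metric

namespace Summit.QuantumFields.BalabanUV.T4Continuum.ShellMeasureRootCompositionFibre

open scoped ENNReal
open Literature.MathematicalPhysics.QuantumFieldTheory.Balaban1983to89
open T4ShellMeasure (SlotAntiConcentration)
open T4ShellMeasureLocal (slotAntiConcentration_of_sections)
open ShellMeasureWilsonTrace (TraceData)
open ShellMeasureWilsonMoving (MLetter mwordEval mdFro sSum lSum)
open ShellMeasureLevelAssembly (classifier weight slotAntiConcentration_of_levelData)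
open ShellMeasureRootCompositionLevelZero (slotAntiConcentration_congr_offNull)

variable {E : Type*} [NormedAddCommGroup E] [NormedSpace ℝ E] [MeasurableSpace E] [BorelSpace E]
  [FiniteDimensional ℝ E] (μ : Measure E) [μ.IsAddHaarMeasure]
variable {A : Type*} [NormedRing A] [NormedAlgebra ℂ A] [CompleteSpace A] [NormOneClass A]

/-! ## §1 One block, exterior frozen: (M1) on the fluctuation space from level data -/

/-- **(M1) ON THE BLOCK FLUCTUATION SPACE ⇐ SM-L1…L6 + DICTIONARY (one block, exterior frozen).**  Data: a
finite-dimensional real normed space `E` (the block's fluctuation coordinates) with an additive Haar measure `μ`; a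
measurable density `F₀` of finite mass and a tested variable `u₀` on `E`; LEVEL DATA in a complete normed `ℂ`-algebra
`A` with trace datum `Ttr` (`N > 0`) — classifier plaquette functionals `hol p` (`p ∈ P_u ≠ ∅`, continuous), weight
words `Gw p` (`p ∈ P_w`), non-Wilson term `𝓔`, window `W`, kept co-tests `Jco`, sizes `s̄ ≤ 1`, `L̄, d̄ ≥ 0`, numbers
`θ > 0`, `0 ≤ δ < 1`, `0 ≤ ρ ≤ (1−δ)/2`, `β ≥ 0`, `Rad > 1`, `H`, `B_𝓔 ≥ 0`.  DICTIONARY: `hFdict` — the density IS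
`Jco · weight Ttr β P_w Gw 𝓔` pointwise; `hudict` — ON THE SUPPORT of `F₀` the tested variable IS `classifier hPu hol`.
BINDERS (E2′'s, NOT instantiated): SM-L5/L6 `hJW`/`hJ`, SM-L1 `hAN`, SM-L3 `hGW`, SM-L4 `hE`, SM-L2 `hSM`.  CONCLUSION:
`SlotAntiConcentration (μ.withDensity F₀) u₀ θ ρ (2(finrank ℝ E + β Σ_p L̄_p(d̄_p + 4s̄_p) + B_𝓔)/(1−δ))`.
CONDITIONAL on every binder; nothing PRINTED is asserted. [folklore] -/
theorem slotAC_block_of_levelData {F₀ : E → ℝ≥0∞} (hF₀ : Measurable F₀) (hfin : (μ.withDensity F₀) univ ≠ ∞)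
    (u₀ : E → ℝ)
    -- level data in the fluctuation coordinates
    (Ttr : TraceData A) (hN : 0 < Ttr.N) {ι κ : Type*} {Pu : Finset ι} (hPu : Pu.Nonempty)
    (hol : ι → E → A) (hcont : ∀ p ∈ Pu, Continuous (hol p))
    (Pw : Finset κ) (Gw : κ → E → A) (𝓔 : E → ℝ) (W : Set E) (Jco : E → ℝ≥0∞)
    {θ δ ρ β Rad H B𝓔 : ℝ} {sw lw dw : κ → ℝ}
    -- DICTIONARY
    (hFdict : ∀ x, F₀ x = Jco x * weight Ttr β Pw Gw 𝓔 x)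
    (hudict : ∀ x, F₀ x ≠ 0 → u₀ x = classifier hPu hol x)
    -- SM-L5/L6: kept co-tests supported in the window, centre-monotone
    (hJW : ∀ x, Jco x ≠ 0 → x ∈ W) (hJ : ∀ x, ∀ a : ℝ, 0 ≤ a → Jco x ≤ Jco (Real.exp (-a) • x))
    -- SM-L1 (AN-bound)
    (hRad : 1 < Rad)
    (hAN : ∀ x ∈ W, ∀ p ∈ Pu, ∃ f : ℂ → A, DifferentiableOn ℂ f (ball 0 Rad) ∧
      (∀ w ∈ ball (0 : ℂ) Rad, ‖f w‖ ≤ H) ∧ f 0 = 0 ∧ ∀ c' : ℝ, 0 ≤ c' → c' ≤ 1 → f (c' : ℂ) = hol p (c' • x) - 1)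
    -- SM-L3 graded sectioned words
    (hGW : ∀ x ∈ W, ∀ p ∈ Pw, ∃ gw : List (MLetter A × ℝ × ℝ), (∀ y ∈ gw, y.1.Good Ttr.τ y.2.1 y.2.2) ∧
      sSum gw ≤ sw p ∧ lSum gw ≤ lw p ∧ mdFro (gw.map Prod.fst) ≤ dw p ∧
      ∀ c' : ℝ, 0 ≤ c' → c' ≤ 1 → mwordEval c' (gw.map Prod.fst) = Gw p (c' • x))
    (hsw1 : ∀ p ∈ Pw, sw p ≤ 1) (hsw0 : ∀ p ∈ Pw, 0 ≤ sw p) (hlw0 : ∀ p ∈ Pw, 0 ≤ lw p)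
    (hdw0 : ∀ p ∈ Pw, 0 ≤ dw p)
    -- SM-L4 non-Wilson ray bound
    (hE : ∀ x ∈ W, ∀ c' : ℝ, 1 / 2 ≤ c' → c' ≤ 1 → 𝓔 (c' • x) ≤ 𝓔 x + (1 - c') * B𝓔) (hB𝓔 : 0 ≤ B𝓔)
    -- numbers + SM-L2 (SM)
    (hθ : 0 < θ) (hδ0 : 0 ≤ δ) (hδ1 : δ < 1) (hρ0 : 0 ≤ ρ) (hρ : ρ ≤ (1 - δ) / 2) (hβ : 0 ≤ β)
    (hSM : 36 * H * 1 ^ 2 / (Rad - 1) ^ 2 ≤ δ * θ) :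
    SlotAntiConcentration (μ.withDensity F₀) u₀ θ ρ
      (2 * ((Module.finrank ℝ E : ℝ) + (β * ∑ p ∈ Pw, lw p * (dw p + 4 * sw p) + B𝓔)) / (1 - δ)) := by
  -- the density rewritten through the dictionary
  have hdens : F₀ = fun x => Jco x * weight Ttr β Pw Gw 𝓔 x := funext hFdict
  -- finiteness of the sub-threshold mass
  have hfin' : (μ.withDensity fun x => Jco x * weight Ttr β Pw Gw 𝓔 x) {x | classifier hPu hol x < θ} ≠ ∞ := by
    rw [← hdens]
    exact ne_top_of_le_ne_top hfin (measure_mono (subset_univ _))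
  -- the one-depth assembly
  have h := slotAntiConcentration_of_levelData μ Ttr hN hPu hol hcont Pw Gw 𝓔 (W := W) (J := Jco) hJW hJ hRad hAN
    hGW hsw1 hsw0 hlw0 hdw0 hE hB𝓔 hθ hδ0 hδ1 hρ0 hρ hβ hSM hfin'
  -- the tested variable is read through the dictionary ON THE SUPPORT; off the support the law vanishes
  have hK : MeasurableSet {x | F₀ x ≠ 0} := hF₀ (measurableSet_singleton 0).compl
  rw [hdens]
  refine slotAntiConcentration_congr_offNull μ hK (fun x hx => ?_) (fun x hx => hudict x hx) h
  have hx' : F₀ x = 0 := by simpa only [mem_setOf_eq, not_not] using hx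
  rw [← hFdict, hx']

/-! ## §2 The fibre END: block fluctuation space × any s-finite exterior law, with density -/

/-- **END-II ON A FLUCTUATION FIBRE — REALIZED (M1) ⇐ SM-L1…L6 + DICTIONARY, PER SLOT, ANY LEVEL, NO PRODUCT HAAR, NO
`SU(2)` CHART, NO GAUGE HYPOTHESIS.**  Data: the block's fluctuation space `E` (finite-dimensional real normed, additive
Haar measure `μ`) and ANY exterior space `Z` with an s-finite law `ζ`; a measurable realized density `F : E × Z → ℝ≥0∞`
of finite mass per exterior point, and a measurable tested variable `u : E × Z → ℝ` — the realized slot law is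
`((μ.prod ζ).withDensity F)` (print's δ-constrained gauge-fixed fluctuation integral (1.25) AFTER its chart of the
«approximate fluctuation field», the chart and its Jacobian inside `F` — DISPLAYED, the [dict] push).  LEVEL DATA per
exterior point `z` (E2′'s, in the fluctuation coordinates): `hol z`, `Gw z`, `𝓔 z`, `W z`, `Jco z`, sizes, numbers;
DICTIONARY `hFdict` (pointwise) ∕ `hudict` (on the support); BINDERS `hJW`/`hJ` (SM-L5/L6), `hAN` (SM-L1), `hGW` (SM-L3),
`hE` (SM-L4), `hSM` (SM-L2).  CONCLUSION: `SlotAntiConcentration ((μ.prod ζ).withDensity F) u θ ρ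
(2(finrank ℝ E + β Σ_p L̄_p(d̄_p + 4s̄_p) + B_𝓔)/(1−δ))` — END-I's `hac` for this slot, consumed by the seam
`ShellMeasureRootCompositionSeam.hac_of_slotConst` unchanged.  Proof: `T4ShellMeasureLocal.slotAntiConcentration_of_sections`
∘ §1.  CONDITIONAL on every binder; nothing PRINTED is asserted. [folklore] -/
theorem slotAC_fibre_of_levelData {Z : Type*} [MeasurableSpace Z] (ζ : Measure Z) [SFinite ζ]
    {F : E × Z → ℝ≥0∞} (hF : Measurable F) (hfin : ∀ z, (μ.withDensity fun x => F (x, z)) univ ≠ ∞)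
    {u : E × Z → ℝ} (hu : Measurable u)
    -- level data per exterior point, in the fluctuation coordinates
    (Ttr : TraceData A) (hN : 0 < Ttr.N) {ι κ : Type*} {Pu : Finset ι} (hPu : Pu.Nonempty)
    (hol : Z → ι → E → A) (hcont : ∀ z, ∀ p ∈ Pu, Continuous (hol z p))
    (Pw : Finset κ) (Gw : Z → κ → E → A) (𝓔 : Z → E → ℝ) (W : Z → Set E) (Jco : Z → E → ℝ≥0∞)
    {θ δ ρ β Rad H B𝓔 : ℝ} {sw lw dw : κ → ℝ}
    -- DICTIONARY
    (hFdict : ∀ z x, F (x, z) = Jco z x * weight Ttr β Pw (Gw z) (𝓔 z) x)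
    (hudict : ∀ z x, F (x, z) ≠ 0 → u (x, z) = classifier hPu (hol z) x)
    -- SM-L5/L6: kept co-tests supported in the window, centre-monotone
    (hJW : ∀ z x, Jco z x ≠ 0 → x ∈ W z)
    (hJ : ∀ z x, ∀ a : ℝ, 0 ≤ a → Jco z x ≤ Jco z (Real.exp (-a) • x))
    -- SM-L1 (AN-bound)
    (hRad : 1 < Rad)
    (hAN : ∀ z, ∀ x ∈ W z, ∀ p ∈ Pu, ∃ f : ℂ → A, DifferentiableOn ℂ f (ball 0 Rad) ∧
      (∀ w ∈ ball (0 : ℂ) Rad, ‖f w‖ ≤ H) ∧ f 0 = 0 ∧ ∀ c' : ℝ, 0 ≤ c' → c' ≤ 1 → f (c' : ℂ) = hol z p (c' • x) - 1)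
    -- SM-L3 graded sectioned words
    (hGW : ∀ z, ∀ x ∈ W z, ∀ p ∈ Pw, ∃ gw : List (MLetter A × ℝ × ℝ), (∀ y ∈ gw, y.1.Good Ttr.τ y.2.1 y.2.2) ∧
      sSum gw ≤ sw p ∧ lSum gw ≤ lw p ∧ mdFro (gw.map Prod.fst) ≤ dw p ∧
      ∀ c' : ℝ, 0 ≤ c' → c' ≤ 1 → mwordEval c' (gw.map Prod.fst) = Gw z p (c' • x))
    (hsw1 : ∀ p ∈ Pw, sw p ≤ 1) (hsw0 : ∀ p ∈ Pw, 0 ≤ sw p) (hlw0 : ∀ p ∈ Pw, 0 ≤ lw p)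
    (hdw0 : ∀ p ∈ Pw, 0 ≤ dw p)
    -- SM-L4 non-Wilson ray bound
    (hE : ∀ z, ∀ x ∈ W z, ∀ c' : ℝ, 1 / 2 ≤ c' → c' ≤ 1 → 𝓔 z (c' • x) ≤ 𝓔 z x + (1 - c') * B𝓔)
    (hB𝓔 : 0 ≤ B𝓔)
    -- numbers + SM-L2 (SM)
    (hθ : 0 < θ) (hδ0 : 0 ≤ δ) (hδ1 : δ < 1) (hρ0 : 0 ≤ ρ) (hρ : ρ ≤ (1 - δ) / 2) (hβ : 0 ≤ β)
    (hSM : 36 * H * 1 ^ 2 / (Rad - 1) ^ 2 ≤ δ * θ) :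
    SlotAntiConcentration ((μ.prod ζ).withDensity F) u θ ρ
      (2 * ((Module.finrank ℝ E : ℝ) + (β * ∑ p ∈ Pw, lw p * (dw p + 4 * sw p) + B𝓔)) / (1 - δ)) :=
  slotAntiConcentration_of_sections μ ζ hF hu fun z =>
    slotAC_block_of_levelData μ (hF.comp measurable_prodMk_right) (hfin z) (fun x => u (x, z)) Ttr hN hPu (hol z)
      (hcont z) Pw (Gw z) (𝓔 z) (W z) (Jco z) (hFdict z) (hudict z) (hJW z) (hJ z) hRad (hAN z) (hGW z) hsw1 hsw0
      hlw0 hdw0 (hE z) hB𝓔 hθ hδ0 hδ1 hρ0 hρ hβ hSM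

/-- **THE COORDINATE CASE `E = ℝ^m`.**  The fibre END with Lebesgue measure on `Fin m → ℝ` (the block's `m` fluctuation
coordinates): constant `2(m + β Σ_p L̄_p(d̄_p + 4s̄_p) + B_𝓔)/(1−δ)` — E2′'s with `n ↦ m`. [folklore] -/
theorem slotAC_fibre_of_levelData_pi {m : ℕ} {Z : Type*} [MeasurableSpace Z] (ζ : Measure Z) [SFinite ζ]
    {F : (Fin m → ℝ) × Z → ℝ≥0∞} (hF : Measurable F)
    (hfin : ∀ z, ((volume : Measure (Fin m → ℝ)).withDensity fun x => F (x, z)) univ ≠ ∞)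
    {u : (Fin m → ℝ) × Z → ℝ} (hu : Measurable u)
    (Ttr : TraceData A) (hN : 0 < Ttr.N) {ι κ : Type*} {Pu : Finset ι} (hPu : Pu.Nonempty)
    (hol : Z → ι → (Fin m → ℝ) → A) (hcont : ∀ z, ∀ p ∈ Pu, Continuous (hol z p))
    (Pw : Finset κ) (Gw : Z → κ → (Fin m → ℝ) → A) (𝓔 : Z → (Fin m → ℝ) → ℝ) (W : Z → Set (Fin m → ℝ))
    (Jco : Z → (Fin m → ℝ) → ℝ≥0∞) {θ δ ρ β Rad H B𝓔 : ℝ} {sw lw dw : κ → ℝ}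
    (hFdict : ∀ z x, F (x, z) = Jco z x * weight Ttr β Pw (Gw z) (𝓔 z) x)
    (hudict : ∀ z x, F (x, z) ≠ 0 → u (x, z) = classifier hPu (hol z) x)
    (hJW : ∀ z x, Jco z x ≠ 0 → x ∈ W z)
    (hJ : ∀ z x, ∀ a : ℝ, 0 ≤ a → Jco z x ≤ Jco z (Real.exp (-a) • x))
    (hRad : 1 < Rad)
    (hAN : ∀ z, ∀ x ∈ W z, ∀ p ∈ Pu, ∃ f : ℂ → A, DifferentiableOn ℂ f (ball 0 Rad) ∧
      (∀ w ∈ ball (0 : ℂ) Rad, ‖f w‖ ≤ H) ∧ f 0 = 0 ∧ ∀ c' : ℝ, 0 ≤ c' → c' ≤ 1 → f (c' : ℂ) = hol z p (c' • x) - 1)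
    (hGW : ∀ z, ∀ x ∈ W z, ∀ p ∈ Pw, ∃ gw : List (MLetter A × ℝ × ℝ), (∀ y ∈ gw, y.1.Good Ttr.τ y.2.1 y.2.2) ∧
      sSum gw ≤ sw p ∧ lSum gw ≤ lw p ∧ mdFro (gw.map Prod.fst) ≤ dw p ∧
      ∀ c' : ℝ, 0 ≤ c' → c' ≤ 1 → mwordEval c' (gw.map Prod.fst) = Gw z p (c' • x))
    (hsw1 : ∀ p ∈ Pw, sw p ≤ 1) (hsw0 : ∀ p ∈ Pw, 0 ≤ sw p) (hlw0 : ∀ p ∈ Pw, 0 ≤ lw p)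
    (hdw0 : ∀ p ∈ Pw, 0 ≤ dw p)
    (hE : ∀ z, ∀ x ∈ W z, ∀ c' : ℝ, 1 / 2 ≤ c' → c' ≤ 1 → 𝓔 z (c' • x) ≤ 𝓔 z x + (1 - c') * B𝓔)
    (hB𝓔 : 0 ≤ B𝓔)
    (hθ : 0 < θ) (hδ0 : 0 ≤ δ) (hδ1 : δ < 1) (hρ0 : 0 ≤ ρ) (hρ : ρ ≤ (1 - δ) / 2) (hβ : 0 ≤ β)
    (hSM : 36 * H * 1 ^ 2 / (Rad - 1) ^ 2 ≤ δ * θ) :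
    SlotAntiConcentration (((volume : Measure (Fin m → ℝ)).prod ζ).withDensity F) u θ ρ
      (2 * ((m : ℝ) + (β * ∑ p ∈ Pw, lw p * (dw p + 4 * sw p) + B𝓔)) / (1 - δ)) := by
  have h := slotAC_fibre_of_levelData (volume : Measure (Fin m → ℝ)) ζ hF hfin hu Ttr hN hPu hol hcont Pw Gw 𝓔 W
    Jco hFdict hudict hJW hJ hRad hAN hGW hsw1 hsw0 hlw0 hdw0 hE hB𝓔 hθ hδ0 hδ1 hρ0 hρ hβ hSM
  simpa only [Module.finrank_fintype_fun_eq_card, Fintype.card_fin] using h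

end Summit.QuantumFields.BalabanUV.T4Continuum.ShellMeasureRootCompositionFibre

end
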